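import Summits.ResolutionOfSingularities.ResolutionOfSingularities.Theorems.FrobeniusClosingPatchingRelPerfectDepthMixedTargetsJR
import Summits.ResolutionOfSingularities.ResolutionOfSingularities.Theorems.FrobeniusClosingPatchingRelPerfectDepthMixedTargetsJCompositions
import HarnessLib

/-!
# Chain W5.2 — «F5J» part 2: the PROVED compositions of the mixed engine with boundary and carried reduced host (F5 v5)

[OURS · L1 W5.2] PROVED compositions over the statement-only module `…DepthMixedTargetsJ` (plan-1 gen 7, TargetsF5J part 1):
the forgetful map `IsWeightedSeqJR.isWeightedSeq`, the iteration `towerMixedJR_of_stepMixedJR`, the packaging `atomConclusion_of_pointwiseTwoMonomial`, and the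
engine compositions `mixedEngineJR_of_targets`, `eside_of_weightTwoBoundaryJR₃`, `mixedEngineJRTwo_threefold` (the `V = ⊤` constructor
`gradedHostFormat_of_retraction` of the reused v3 format is the tree's, `…DepthMixedTargetsBCompositions` p511534).  Fact-free;
F-32bR enters only inside `WeightTwoBoundaryJR₃`.  NOT statements of the manuscript under review; AI-typed, weaker than expert review.

NAMING (filer's note): plan-1's `ChainW52TargetsF5JCompositions.lean` v5.1 sha16 03b1ef5ecf047a68 VERBATIM with the `JR` tag on every name
(see `…DepthMixedTargetsJR`); the packaging `atomConclusion_of_pointwiseTwoMonomial` (text unchanged from v4) is REUSED from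
`…DepthMixedTargetsJCompositions` (p513723) by import.
-/

-- `Summit.<Summit>.<Sub>.Theorems` with `Sub = Summit` (single-conjunct summit, D-0017)
set_option linter.dupNamespace false

noncomputable section

open CategoryTheory CategoryTheory.Limits AlgebraicGeometry TopologicalSpace
open Literature.AlgebraicGeometry.Resolution
open Scheme.IdealSheafData

namespace Summit.ResolutionOfSingularities.ResolutionOfSingularities.Theorems.DepthTargets

universe u


/-- Forgetting the boundary and the host: a weighted sequence with boundary is a weighted sequence (F2); the factor law of each
step is `pow_mul_controlledTransform_eq` (BGMW Lemma 3.2.1 (2)). [cite: BierstoneGrigorievMilmanWlodarczyk2011, §3.2 Lemma 3.2.1] -/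
theorem IsWeightedSeqJR.isWeightedSeq {μ : ℕ} :
    ∀ {E' E : Scheme.{u}} {ρ : E' ⟶ E} {𝔟 D : E.IdealSheafData} {ℬ 𝒟 : List (E.IdealSheafData × ℕ)}
      {𝔟' D' : E'.IdealSheafData} {ℬ' 𝒟' : List (E'.IdealSheafData × ℕ)},
      IsWeightedSeqJR μ ρ 𝔟 D ℬ 𝒟 𝔟' D' ℬ' 𝒟' → IsWeightedSeq μ ρ 𝔟 𝔟'
  | _, _, _, _, _, _, _, _, _, _, _, .nil 𝔟 D ℬ 𝒟 _ _ => .nil 𝔟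
  | _, _, _, _, _, _, _, _, _, _, _, .cons τ ρ 𝔟 D ℬ 𝒟 𝔟' D' ℬ' 𝒟' C ν m h hC _ h1 hν hle _ _ _ _ _ _ _ hτ _ _ => by
    refine .cons τ ρ 𝔟 𝔟' _ C ν h.isWeightedSeq hC h1 hν hle hτ ?_
    refine (hτ.pow_mul_controlledTransform_eq ?_).symm
    have h' : 𝔟'.comap τ ≤ (C ^ ν).comap τ := Scheme.IdealSheafData.comap_mono (f := τ) hle
    rwa [comap_pow] at h'

/-- **Iterating formatted mixed steps WITH BOUNDARY along a weighted sequence with boundary** (p504758's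
`towerMixed_of_stepMixed` with the boundary and the carried host threaded): induction on `IsWeightedSeqJR`.
[cite: BierstoneGrigorievMilmanWlodarczyk2011, §3.2 Lemma 3.2.1] -/
theorem towerMixedJR_of_stepMixedJR {ℓ : ℕ}
    {P : ∀ ⦃E X : Scheme.{u}⦄, (E ⟶ X) → X.IdealSheafData → X.IdealSheafData → E.IdealSheafData →
      List (E.IdealSheafData × ℕ) → List (E.IdealSheafData × ℕ) → Prop}
    (hstep : StepMixedJR ℓ P) : TowerMixedJR ℓ P := by
  have key : ∀ {E' E : Scheme.{u}} {ρ : E' ⟶ E} {𝔟 D : E.IdealSheafData} {ℬ 𝒟 : List (E.IdealSheafData × ℕ)}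
      {𝔟' D' : E'.IdealSheafData} {ℬ' 𝒟' : List (E'.IdealSheafData × ℕ)},
      IsWeightedSeqJR ℓ ρ 𝔟 D ℬ 𝒟 𝔟' D' ℬ' 𝒟' →
      ∀ (S : Type u) [CommRing S] [IsRegularLocalRing S] (I : Ideal S) (X : Scheme.{u}) (i : E ⟶ X)
        (g : X ⟶ Spec (.of S)) (K N : X.IdealSheafData),
        DepthInvariantMono ℓ S I E X i g K N → P i K N D ℬ 𝒟 → K.comap i = 𝔟 →
        ∃ (X' : Scheme.{u}) (π : X' ⟶ X) (i' : E' ⟶ X') (K' N' : X'.IdealSheafData),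
          IsWeightedSeq ℓ π K K' ∧ i' ≫ π = ρ ≫ i ∧
          DepthInvariantMono ℓ S I E' X' i' (π ≫ g) K' N' ∧ K'.comap i' = 𝔟' ∧ P i' K' N' D' ℬ' 𝒟' := by
    intro E' E ρ 𝔟 D ℬ 𝒟 𝔟' D' ℬ' 𝒟' hseq
    induction hseq with
    | nil 𝔟 D ℬ 𝒟 _ _ =>
      intro S _ _ I X i g K N hinv hP h𝔟
      exact ⟨X, 𝟙 X, i, K, N, .nil K, by simp, by simpa using hinv, h𝔟, hP⟩
    | cons τ ρ 𝔟 D ℬ 𝒟 𝔟₁ D₁ ℬ₁ 𝒟₁ C ν m hρ hC hconn h1 hν hle hDm hsplit hsnc hUℬ hU𝒟 hjoint hmax hτ hnb hne ih =>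
      intro S _ _ I X i g K N hinv hP h𝔟
      obtain ⟨X₁, π, i₁, K₁, N₁, hXseq, hsq, hinv₁, hK₁, hP₁⟩ := ih S I X i g K N hinv hP h𝔟
      have hle' : K₁.comap i₁ ≤ C ^ ν := hK₁ ▸ hle
      have hmax' : ν < ℓ → ∀ z : _, z ∈ C.support → ¬ stalkIdeal (K₁.comap i₁) z ≤ stalkIdeal C z ^ (ν + 1) := by
        rw [hK₁]; exact hmax
      obtain ⟨hperm, X₂, σ, i₂, hσ, hsq₂, hinv₂, hK₂, hP₂⟩ :=
        hstep S I _ X₁ i₁ (π ≫ g) K₁ N₁ D₁ ℬ₁ 𝒟₁ hinv₁ hP₁ _ τ C ν m hC hconn h1 hν hle' hDm hsplit hsnc hUℬ hU𝒟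
          hjoint hmax' hτ hnb hne
      haveI := hinv₁.isClosedImmersion
      refine ⟨X₂, σ ≫ π, i₂, controlledTransform σ (C.map i₁) K₁ ν,
        N₁.comap σ * (C.map i₁).comap σ ^ (ℓ - ν), ?_, ?_, ?_, ?_, hP₂⟩
      · refine .cons σ π K K₁ _ (C.map i₁) ν hXseq (DepthOne.isRegular_subscheme_map i₁ C hC) h1 hν hperm hσ ?_
        refine (hσ.pow_mul_controlledTransform_eq ?_).symm
        have h : K₁.comap σ ≤ ((C.map i₁) ^ ν).comap σ :=
          Scheme.IdealSheafData.comap_mono (f := σ) hperm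
        rwa [comap_pow] at h
      · rw [Category.assoc, ← hsq, ← Category.assoc, hsq₂, Category.assoc]
      · rw [Category.assoc]; exact hinv₂
      · rw [hK₂, hK₁]
  intro S _ _ I E X i g K N D ℬ 𝒟 hinv hP E' ρ 𝔟' D' ℬ' 𝒟' hseq
  exact key hseq S I X i g K N hinv hP rfl

/-- **PROVED COMPOSITION — the mixed engine from its four targets** (one boundary-carrying format `P`): initial format ⇒
tower along the E-side sequence with boundary ⇒ local two-monomial presentation at the end ⇒ local pair game ⇒ D5. Fact-free.
[cite: Kollar2007, (3.111) Step 3] [cite: BierstoneGrigorievMilmanWlodarczyk2011, §3.2] -/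
theorem mixedEngineJR_of_targets {ℓ : ℕ}
    (P : ∀ ⦃E X : Scheme.{u}⦄, (E ⟶ X) → X.IdealSheafData → X.IdealSheafData → E.IdealSheafData →
      List (E.IdealSheafData × ℕ) → List (E.IdealSheafData × ℕ) → Prop)
    (hinit : InitialJR ℓ P) (htower : TowerMixedJR ℓ P) (hend : EndTwoMonomialJR ℓ P) (hpair : PointwisePairGame.{u}) :
    MixedEngineJR.{u} ℓ := by
  intro S _ _ I hI E X i g K 𝓗 hinv hfmt hE T f hf
  obtain ⟨E', ρ, 𝔟', D', ℬ', 𝒟', hseq, hendE⟩ := hE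
  have hinv₀ : DepthInvariantMono ℓ S I E X i g K ⊤ := DepthInvariantMono.of_depthInvariant hinv
  have hP₀ : P i K ⊤ (K.comap i) ([] : List (E.IdealSheafData × ℕ)) ([] : List (E.IdealSheafData × ℕ)) :=
    hinit S I E X i g K 𝓗 hinv hfmt
  obtain ⟨X', π, i', K', N', -, -, hinv', hK', hP'⟩ :=
    htower S I E X i g K ⊤ (K.comap i) [] [] hinv₀ hP₀ E' ρ 𝔟' D' ℬ' 𝒟' hseq
  obtain ⟨M₀, A, B, hM₀, hAB, hsnc, hK'eq⟩ :=
    hend S I E' X' i' (π ≫ g) K' N' D' ℬ' 𝒟' hinv' hP' (hK' ▸ hendE)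
  exact atomConclusion_of_pointwiseTwoMonomial hpair hI hinv' hM₀ hAB hsnc hK'eq T f hf

/-- **The E-side datum of `MixedEngineJR 2` from T5-E** (projection): on an integral Noetherian regular excellent threefold, a
non-zero locally principal `K|_E` WITH REDUCED ZERO SCHEME admits the required weighted sequence with boundary, mod F-32bR.
[cite: CossartJannsenSaito2020, Thm. 1.4] -/
theorem eside_of_weightTwoBoundaryJR₃ (hW : WeightTwoBoundaryJR₃.{u}) (hCJS : CossartJannsenSaito2020EmbeddedSequenceB.{u})
    (E : Scheme.{u}) [IsIntegral E] [IsNoetherian E] (hreg : Scheme.IsRegular E) (hexc : Scheme.IsExcellent E)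
    (hdim : topologicalKrullDim E = 3) (𝔟 : E.IdealSheafData) (h𝔟 : 𝔟 ≠ ⊥) (hlp : IsLocallyPrincipal 𝔟)
    (hred : IsReduced 𝔟.subscheme) :
    ∃ (E' : Scheme.{u}) (ρ : E' ⟶ E) (𝔟' D' : E'.IdealSheafData) (ℬ' 𝒟' : List (E'.IdealSheafData × ℕ)),
      IsWeightedSeqJR 2 ρ 𝔟 𝔟 [] [] 𝔟' D' ℬ' 𝒟' ∧ EndStateJR 𝔟' D' ℬ' := by
  obtain ⟨E', ρ, 𝔟', D', ℬ', 𝒟', hseq, -, -, -, hend⟩ := hW hCJS E hreg hexc hdim 𝔟 h𝔟 hlp hred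
  exact ⟨E', ρ, 𝔟', D', ℬ', 𝒟', hseq, hend⟩

/-- **The depth-two mixed engine on excellent regular threefolds, assembled** (PROVED composition): the format targets at
`ℓ = 2`, the local pair game and T5-E give the conclusion of the CORE at every initial graded-host state of depth two whose
exceptional scheme `E` is an integral Noetherian regular excellent threefold and whose E-side datum is non-zero, locally
principal and has REDUCED zero scheme — i.e. for every ONE-FORM state with squarefree host trace — modulo F-32bR (inside T5-E only).
[cite: Kollar2007, (3.111) Step 3] [cite: CossartJannsenSaito2020, Thm. 1.4] -/
theorem mixedEngineJRTwo_threefold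
    (P : ∀ ⦃E X : Scheme.{u}⦄, (E ⟶ X) → X.IdealSheafData → X.IdealSheafData → E.IdealSheafData →
      List (E.IdealSheafData × ℕ) → List (E.IdealSheafData × ℕ) → Prop)
    (hinit : InitialJR 2 P) (htower : TowerMixedJR 2 P) (hend : EndTwoMonomialJR 2 P) (hpair : PointwisePairGame.{u})
    (hW : WeightTwoBoundaryJR₃.{u}) (hCJS : CossartJannsenSaito2020EmbeddedSequenceB.{u})
    {S : Type u} [CommRing S] [IsRegularLocalRing S] {I : Ideal S} (hI : I ≠ ⊥)
    {E X : Scheme.{u}} [IsIntegral E] [IsNoetherian E] (hexc : Scheme.IsExcellent E) (hdim : topologicalKrullDim E = 3)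
    {i : E ⟶ X} {g : X ⟶ Spec (.of S)} {K 𝓗 : X.IdealSheafData}
    (hinv : DepthInvariant 2 S I E X i g K) (hfmt : GradedHostFormat 2 i K 𝓗)
    (hK : K.comap i ≠ ⊥) (hlp : IsLocallyPrincipal (K.comap i)) (hred : IsReduced (K.comap i).subscheme)
    (T : Scheme.{u}) (f : T ⟶ Spec (.of S)) (hf : IsBlowup f (affineBlowup.idealSheaf I)) :
    ∃ (J : T.IdealSheafData) (T' : Scheme.{u}) (π : T' ⟶ T), J ≠ ⊥ ∧
      (∀ t : T, t ∈ J.support → f.base t = IsLocalRing.closedPoint S) ∧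
      IsBlowup π J ∧ Scheme.IsRegular T' :=
  mixedEngineJR_of_targets P hinit htower hend hpair S I hI E X i g K 𝓗 hinv hfmt
    (eside_of_weightTwoBoundaryJR₃ hW hCJS E hinv.isRegular_exc hexc hdim (K.comap i) hK hlp hred) T f hf

end Summit.ResolutionOfSingularities.ResolutionOfSingularities.Theorems.DepthTargets

end
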